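import Literature.NumberTheory.Transcendental.FormsAlgebra
import HarnessLib

/-!
# The Leibniz rule for the wedge product, and smoothness of wedges (named facts discharged)

Topic: algebra of differential forms (`Literature/NumberTheory/Transcendental/FormsAlgebra.lean`).
This theorems-mostly companion file discharges the two named facts of that file about the wedge
product on one manifold,

| named fact of `FormsAlgebra.lean`                                   | discharged by                 |
|---------------------------------------------------------------------|-------------------------------|
| `Literature.NumberTheory.Transcendental.IsSmoothFormWedge I M A`    | `IsSmoothFormWedge_holds`     |
| `Literature.NumberTheory.Transcendental.MextDerivWedge I M A`       | `MextDerivWedge_holds`        |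

i.e. for smooth `A`-valued forms on a real manifold `M` (model with corners `I`, any normed
commutative `ℝ`-algebra `A` of coefficients, all degrees): `α ∧ β` is smooth (Warner (1983), 2.17)
and `d(α ∧ β) = dα ∧ β + (-1)^k α ∧ dβ` (Warner (1983), Thm. 2.20: `d` is an *antiderivation* of
degree `+1`, antiderivations being defined in 2.11(b); this is property (d) in the proof of 2.20;
Bott–Tu (1982), §I.1, (1.5)),
for the tree's concrete `∧` (shuffle normalisation `(k! l!)⁻¹ ∑_σ sign σ · α(vσ|₁) β(vσ|₂)`,
`ContinuousAlternatingMap.wedge`) and `d` (Mathlib's `extDerivWithin` in the chart at the point,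
`Literature.Geometry.Kaehler.mextDeriv`). With these, the hypothesis class `WedgeFacts I M A` of
`FormsAlgebra.lean` reduces to the two pointwise algebraic facts (`wedgeFacts_of_assoc_comm`).

## Main statements (all proved)

* `sum_perm_sign_smul_comp_eq_sum_cons`: the first-slot expansion of an alternating sum over all
  permutations of `Fin (N+1)` (the combinatorics of the Laplace expansion
  `Matrix.det_succ_column_zero`), through the explicit bijection `consPerm`.
* `wedgeCLM`: `∧` as a continuous bilinear map (norm bound `‖α ∧ β‖ ≤ (k+l)! ‖α‖ ‖β‖`,
  `norm_wedge_le`); `ContDiffWithinAt.wedge`.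
* `alternatizeUncurryFin_wedge_left/right`: for a linear family `φ` and a fixed form `ψ`,
  `alternatizeUncurryFin (v ↦ φ v ∧ ψ) = (alternatizeUncurryFin φ) ∧ ψ` and
  `alternatizeUncurryFin (v ↦ ψ ∧ φ v) = (-1)^k ψ ∧ alternatizeUncurryFin φ` — the two halves of
  the Leibniz rule at the level of Mathlib's `ContinuousAlternatingMap.alternatizeUncurryFin`
  (`extDerivWithin = alternatizeUncurryFin ∘ fderivWithin`).
* `extDerivWithin_wedge`: the flat Leibniz rule on a normed space (within a set, at a point of
  unique differentiability).
* `mfderiv_extChartAt_self_of_chartedSpace`, `mfderivWithin_extChartAt_symm_self_of_chartedSpace`,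
  `inChart_apply_self_of_chartedSpace`, `mextDeriv_eq_extDerivWithin_of_chartedSpace`: the chart at
  a point on a *bare* charted space (the tree's `mextDeriv_eq_extDerivWithin` and
  `MForm.inChart_apply_self` assume `IsManifold I ∞ M`, which `MextDerivWedge` does not provide).
* `IsSmoothFormWedge_holds`, `MextDerivWedge_holds`, `wedgeFacts_of_assoc_comm`.

## Proof architecture (vs. Warner)

Warner obtains the antiderivation property (property (d) in the proof of Thm. 2.20) for the `d`
*defined* by the local formula `d(a_Φ dx_Φ) = da_Φ ∧ dx_Φ` (2.20(4)), where the rule is immediate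
from `d(fg) = f dg + g df`. Here `d` is Mathlib's
`dω(v₀,…,vₙ) = ∑ᵢ (-1)^i D_{vᵢ}ω(…v̂ᵢ…)` and `∧` is the full-permutation shuffle sum, so the rule
is the pair of identities `alternatizeUncurryFin_wedge_left/right` between signed sums over
`𝔖_{k+l+1}`: both sides are brought to `(k! l!)⁻¹ ∑_τ sign τ · F(v ∘ τ)` — the left by the
first-slot expansion (`τ ↦ (τ 0, rest)`), the right by moving the distinguished slot of
`alternatizeUncurryFin` to the front with a cycle `Fin.cycleRange` of sign `(-1)^j`
(resp. `(-1)^{k+j}`), and counting `(k+1)·((k+1)! l!)⁻¹ = (k! l!)⁻¹`. The derivative of the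
bilinear `y ↦ α(y) ∧ β(y)` is Mathlib's `ContinuousLinearMap.fderivWithin_of_bilinear` for
`wedgeCLM`; on the manifold both sides live in the chart at the point, where
`(α ∧ β).inChart = α.inChart ∧ β.inChart` (`inChart_wedge`, naturality of `∧` under the linear
chart derivative, already in `FormsAlgebra.lean`).

## References

* F. W. Warner, *Foundations of Differentiable Manifolds and Lie Groups*, GTM 94, Springer (1983),
  2.6 (bilinearity of `∧`), 2.10(b) (shuffle formula), 2.11(b) (antiderivations:
  `l(u ∧ v) = l(u) ∧ v + (-1)^p u ∧ l(v)`), 2.17 (smooth forms), Thm. 2.20 (`d` is the unique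
  antiderivation of degree `+1` with `d² = 0` and `df` the differential; property (d) of the proof).
* R. Bott, L. W. Tu, *Differential Forms in Algebraic Topology*, GTM 82, Springer (1982), §I.1,
  (1.5) (antiderivation property of `d`).
* Mathlib: `Mathlib/Analysis/Calculus/DifferentialForm/Basic.lean` (`extDerivWithin`),
  `Mathlib/Analysis/Normed/Module/Alternating/Uncurry/Fin.lean` (`alternatizeUncurryFin`),
  `Mathlib/LinearAlgebra/Matrix/Determinant/Basic.lean` (`det_succ_column_zero`, same
  combinatorics), `Mathlib/GroupTheory/Perm/Fin.lean` (`Fin.cycleRange`, `Equiv.Perm.decomposeFin`).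
-/

noncomputable section

open scoped Manifold ContDiff Topology
open Set Function

namespace Literature.NumberTheory.Transcendental

/-! ### First-slot expansion of an alternating sum over all permutations -/

section FirstSlot

variable {V : Type*} {β : Type*} [AddCommGroup β] {N : ℕ}

/-- The permutation of `Fin (N + 1)` sending `0 ↦ p` and `m + 1 ↦ p.succAbove (e m)`:
the inverse of the cycle `(0 1 … p)` followed by the permutation `e` of the remaining slots
(`Fin.cycleRange`, `Equiv.Perm.decomposeFin`). [folklore] -/
def consPerm (p : Fin (N + 1)) (e : Equiv.Perm (Fin N)) : Equiv.Perm (Fin (N + 1)) :=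
  (Equiv.Perm.decomposeFin.symm (0, e)).trans p.cycleRange.symm

/-- `consPerm p e 0 = p`. [folklore] -/
theorem consPerm_zero (p : Fin (N + 1)) (e : Equiv.Perm (Fin N)) : consPerm p e 0 = p := by
  simp [consPerm]

/-- `consPerm p e (m+1) = p.succAbove (e m)`. [folklore] -/
theorem consPerm_succ (p : Fin (N + 1)) (e : Equiv.Perm (Fin N)) (m : Fin N) :
    consPerm p e m.succ = p.succAbove (e m) := by
  simp [consPerm]

/-- `sign (consPerm p e) = (-1)^p sign e` (the inverse cycle `(0 1 … p)⁻¹` has sign `(-1)^p`,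
`Fin.sign_cycleRange`). [folklore] -/
theorem sign_consPerm (p : Fin (N + 1)) (e : Equiv.Perm (Fin N)) :
    (Equiv.Perm.sign (consPerm p e) : ℤ) = (-1) ^ (p : ℕ) * (Equiv.Perm.sign e : ℤ) := by
  rw [consPerm, Equiv.Perm.sign_trans, Equiv.Perm.sign_symm, Fin.sign_cycleRange,
    Equiv.Perm.decomposeFin.symm_sign, if_pos rfl, one_mul, Units.val_mul]
  congr 1

/-- Precomposing a tuple with `consPerm p e` puts `w p` in front of the remaining entries permuted
by `e`: `w ∘ consPerm p e = (w p, (w with w_p removed) ∘ e)`. [folklore] -/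
theorem comp_consPerm (w : Fin (N + 1) → V) (p : Fin (N + 1)) (e : Equiv.Perm (Fin N)) :
    w ∘ consPerm p e = Fin.cons (w p) (p.removeNth w ∘ e) := by
  funext m
  refine Fin.cases ?_ (fun i ↦ ?_) m
  · simp [consPerm_zero]
  · simp [consPerm_succ, Fin.removeNth]

/-- `(p, e) ↦ consPerm p e` is injective (evaluate at `0`, then cancel the cycle). [folklore] -/
theorem consPerm_injective :
    Function.Injective (fun pe : Fin (N + 1) × Equiv.Perm (Fin N) ↦ consPerm pe.1 pe.2) := by
  rintro ⟨p, e⟩ ⟨p', e'⟩ h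
  have hp : p = p' := by
    have := congrArg (fun σ : Equiv.Perm (Fin (N + 1)) ↦ σ 0) h
    simpa [consPerm_zero] using this
  subst hp
  have he : Equiv.Perm.decomposeFin.symm (0, e) = Equiv.Perm.decomposeFin.symm (0, e') := by
    have h' : (consPerm p e).trans p.cycleRange = (consPerm p e').trans p.cycleRange := by
      rw [show consPerm p e = consPerm p e' from h]
    simpa [consPerm, Equiv.trans_assoc] using h'
  have := Equiv.Perm.decomposeFin.symm.injective he
  simp only [Prod.mk.injEq, true_and] at this
  rw [this]

/-- `(p, e) ↦ consPerm p e` is a bijection `Fin (N+1) × 𝔖_N ≃ 𝔖_{N+1}` (injective between finite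
types of the same cardinality `(N+1)·N! = (N+1)!`): the decomposition of a permutation according to
the image of `0`. [folklore] -/
theorem consPerm_bijective :
    Function.Bijective (fun pe : Fin (N + 1) × Equiv.Perm (Fin N) ↦ consPerm pe.1 pe.2) := by
  refine (Fintype.bijective_iff_injective_and_card _).2 ⟨consPerm_injective, ?_⟩
  simp [Fintype.card_perm, Nat.factorial_succ]

/-- **First-slot expansion of an alternating sum.** For any function `f` of `(N+1)`-tuples,
`∑_{τ ∈ 𝔖_{N+1}} sign τ · f(w ∘ τ) = ∑_{p} (-1)^p ∑_{e ∈ 𝔖_N} sign e · f(w_p, (w with w_p removed) ∘ e)`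
(the decomposition of a permutation according to the image of `0`; the combinatorial identity
behind the Laplace expansion `Matrix.det_succ_column_zero`). [folklore] -/
theorem sum_perm_sign_smul_comp_eq_sum_cons (f : (Fin (N + 1) → V) → β) (w : Fin (N + 1) → V) :
    ∑ τ : Equiv.Perm (Fin (N + 1)), (Equiv.Perm.sign τ : ℤ) • f (w ∘ τ) =
      ∑ p : Fin (N + 1), (-1 : ℤ) ^ (p : ℕ) •
        ∑ e : Equiv.Perm (Fin N), (Equiv.Perm.sign e : ℤ) • f (Fin.cons (w p) (p.removeNth w ∘ e)) := by
  rw [← Fintype.sum_bijective _ consPerm_bijective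
    (fun pe ↦ (Equiv.Perm.sign (consPerm pe.1 pe.2) : ℤ) • f (w ∘ consPerm pe.1 pe.2))
    _ (fun _ ↦ rfl), Fintype.sum_prod_type]
  refine Finset.sum_congr rfl fun p _ ↦ ?_
  rw [Finset.smul_sum]
  refine Finset.sum_congr rfl fun e _ ↦ ?_
  dsimp only
  rw [sign_consPerm, comp_consPerm, mul_smul]

end FirstSlot

end Literature.NumberTheory.Transcendental

namespace Literature.NumberTheory.Transcendental

/-! ### The wedge product is a continuous bilinear map -/

section WedgeCLM

variable {𝕜 : Type*} [RCLike 𝕜] {V : Type*} [NormedAddCommGroup V] [NormedSpace 𝕜 V]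
  {A : Type*} [NormedCommRing A] [NormedAlgebra 𝕜 A] {k l : ℕ}

/-- Norm bound for the wedge product: `‖(α ∧ β)(v)‖ ≤ (k+l)! ‖α‖ ‖β‖ ∏ ‖vᵢ‖` (from the shuffle
formula, each of the `(k+l)!` summands being bounded by `‖α‖ ‖β‖ ∏ ‖vᵢ‖`, and
`(k! l!)⁻¹ ≤ 1`). [folklore] -/
theorem norm_wedge_apply_le (α : V [⋀^Fin k]→L[𝕜] A) (β : V [⋀^Fin l]→L[𝕜] A)
    (v : Fin (k + l) → V) :
    ‖α.wedge β v‖ ≤ ((k + l).factorial : ℝ) * ‖α‖ * ‖β‖ * ∏ i, ‖v i‖ := by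
  rw [ContinuousAlternatingMap.wedge_apply]
  have hc : ‖(((k.factorial * l.factorial : ℕ) : 𝕜)⁻¹)‖ ≤ 1 := by
    rw [norm_inv, RCLike.norm_natCast]
    have h1 : 1 ≤ k.factorial * l.factorial :=
      Nat.one_le_iff_ne_zero.2 (Nat.mul_ne_zero (Nat.factorial_ne_zero k) (Nat.factorial_ne_zero l))
    exact inv_le_one_of_one_le₀ (by exact_mod_cast h1)
  have hterm : ∀ σ : Equiv.Perm (Fin (k + l)),
      ‖Equiv.Perm.sign σ • (α (fun i ↦ v (σ (Fin.castAdd l i))) *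
        β (fun j ↦ v (σ (Fin.natAdd k j))))‖ ≤ ‖α‖ * ‖β‖ * ∏ i, ‖v i‖ := by
    intro σ
    rw [norm_units_zsmul]
    refine (norm_mul_le _ _).trans ?_
    have hα := α.le_opNorm (fun i ↦ v (σ (Fin.castAdd l i)))
    have hβ := β.le_opNorm (fun j ↦ v (σ (Fin.natAdd k j)))
    have hprod : (∏ i : Fin k, ‖v (σ (Fin.castAdd l i))‖) * ∏ j : Fin l, ‖v (σ (Fin.natAdd k j))‖ =
        ∏ i, ‖v i‖ := by
      rw [← Fin.prod_univ_add (fun m ↦ ‖v (σ m)‖), Equiv.prod_comp σ (fun m ↦ ‖v m‖)]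
    calc ‖α (fun i ↦ v (σ (Fin.castAdd l i)))‖ * ‖β (fun j ↦ v (σ (Fin.natAdd k j)))‖
        ≤ (‖α‖ * ∏ i : Fin k, ‖v (σ (Fin.castAdd l i))‖) *
            (‖β‖ * ∏ j : Fin l, ‖v (σ (Fin.natAdd k j))‖) :=
          mul_le_mul hα hβ (norm_nonneg _) (by positivity)
      _ = ‖α‖ * ‖β‖ * ∏ i, ‖v i‖ := by rw [← hprod]; ring
  calc ‖(((k.factorial * l.factorial : ℕ) : 𝕜)⁻¹) • ∑ σ : Equiv.Perm (Fin (k + l)),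
        Equiv.Perm.sign σ • (α (fun i ↦ v (σ (Fin.castAdd l i))) *
          β (fun j ↦ v (σ (Fin.natAdd k j))))‖
      ≤ 1 * ∑ σ : Equiv.Perm (Fin (k + l)), (‖α‖ * ‖β‖ * ∏ i, ‖v i‖) := by
        rw [norm_smul]
        exact mul_le_mul hc (norm_sum_le_of_le _ fun σ _ ↦ hterm σ) (norm_nonneg _) zero_le_one
    _ = ((k + l).factorial : ℝ) * ‖α‖ * ‖β‖ * ∏ i, ‖v i‖ := by
        rw [Finset.sum_const, Finset.card_univ, Fintype.card_perm, Fintype.card_fin, nsmul_eq_mul]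
        ring

/-- Norm bound for the wedge product as a bilinear map: `‖α ∧ β‖ ≤ (k+l)! ‖α‖ ‖β‖`. [folklore] -/
theorem norm_wedge_le (α : V [⋀^Fin k]→L[𝕜] A) (β : V [⋀^Fin l]→L[𝕜] A) :
    ‖α.wedge β‖ ≤ ((k + l).factorial : ℝ) * ‖α‖ * ‖β‖ :=
  (α.wedge β).opNorm_le_bound (by positivity) fun v ↦ norm_wedge_apply_le α β v

variable (𝕜 V A k l) in
/-- **The wedge product as a continuous bilinear map**
`(V [⋀^k] A) →L (V [⋀^l] A) →L (V [⋀^{k+l}] A)` (bilinearity: Warner (1983), 2.6; continuity from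
the bound `‖α ∧ β‖ ≤ (k+l)! ‖α‖ ‖β‖`). It is through this map that the calculus of Mathlib's
bilinear `fderiv` lemmas applies to `y ↦ α(y) ∧ β(y)`. [cite: WarnerGTM94, 2.6] -/
def wedgeCLM : (V [⋀^Fin k]→L[𝕜] A) →L[𝕜] (V [⋀^Fin l]→L[𝕜] A) →L[𝕜] (V [⋀^Fin (k + l)]→L[𝕜] A) :=
  LinearMap.mkContinuous₂
    (LinearMap.mk₂ 𝕜 (fun α β ↦ α.wedge β) ContinuousAlternatingMap.wedge_add_left
      ContinuousAlternatingMap.wedge_smul_left ContinuousAlternatingMap.wedge_add_right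
      ContinuousAlternatingMap.wedge_smul_right)
    ((k + l).factorial : ℝ) fun α β ↦ norm_wedge_le α β

/-- `wedgeCLM α β = α ∧ β` (definitional). [folklore] -/
@[simp]
theorem wedgeCLM_apply (α : V [⋀^Fin k]→L[𝕜] A) (β : V [⋀^Fin l]→L[𝕜] A) :
    wedgeCLM 𝕜 V A k l α β = α.wedge β :=
  rfl

/-- The wedge product is jointly continuous (indeed a bounded bilinear map). [folklore] -/
theorem isBoundedBilinearMap_wedge :
    IsBoundedBilinearMap 𝕜 fun p : (V [⋀^Fin k]→L[𝕜] A) × (V [⋀^Fin l]→L[𝕜] A) ↦ p.1.wedge p.2 :=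
  (wedgeCLM 𝕜 V A k l).isBoundedBilinearMap

/-- The wedge product of two `C^n` families of alternating maps is `C^n` (within a set, at a
point). Deliberate dot-notation extension of the Mathlib namespace `ContDiffWithinAt` (like
`ContinuousAlternatingMap.wedge` itself). [folklore] -/
theorem _root_.ContDiffWithinAt.wedge {X : Type*} [NormedAddCommGroup X] [NormedSpace 𝕜 X]
    {n : WithTop ℕ∞} {f : X → V [⋀^Fin k]→L[𝕜] A} {g : X → V [⋀^Fin l]→L[𝕜] A} {s : Set X} {x : X}
    (hf : ContDiffWithinAt 𝕜 n f s x) (hg : ContDiffWithinAt 𝕜 n g s x) :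
    ContDiffWithinAt 𝕜 n (fun y ↦ (f y).wedge (g y)) s x := by
  have h := (isBoundedBilinearMap_wedge (𝕜 := 𝕜) (V := V) (A := A) (k := k) (l := l)).contDiff
    (n := n)
  rw [show (fun y ↦ (f y).wedge (g y)) =
    (fun p : (V [⋀^Fin k]→L[𝕜] A) × (V [⋀^Fin l]→L[𝕜] A) ↦ p.1.wedge p.2) ∘ fun y ↦ (f y, g y)
    from rfl]
  exact h.comp_contDiffWithinAt (hf.prodMk hg)

end WedgeCLM

/-! ### Smoothness of the wedge of smooth forms (`IsSmoothFormWedge` discharged) -/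

section Smooth

variable {E : Type*} [NormedAddCommGroup E] [NormedSpace ℝ E]
  {H : Type*} [TopologicalSpace H] {I : ModelWithCorners ℝ E H}
  {M : Type*} [TopologicalSpace M] [ChartedSpace H M]
  {A : Type*} [NormedCommRing A] [NormedAlgebra ℝ A] {k l : ℕ}

/-- The chart representative of a wedge is the wedge of the chart representatives (pointwise
naturality of `∧` under the derivative of the inverse chart; Warner (1983), 2.22(c)). [folklore] -/
theorem inChart_wedge (α : Literature.Geometry.Kaehler.MForm I M A k)
    (β : Literature.Geometry.Kaehler.MForm I M A l) (x₀ : M) :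
    (α.wedge β).inChart x₀ = fun y ↦ (α.inChart x₀ y).wedge (β.inChart x₀ y) := by
  funext y
  exact ContinuousAlternatingMap.wedge_compContinuousLinearMap (V := E) (W := E) _ _ _

variable (I M A) in
/-- Discharge of the named fact `Literature.NumberTheory.Transcendental.IsSmoothFormWedge`: **the
wedge of smooth forms is smooth** (Warner (1983), 2.17: `E*(M)`-valued products of smooth forms
are smooth). In each chart the representative of `α ∧ β` is the wedge of the representatives
(`inChart_wedge`), a continuous bilinear image (`wedgeCLM`) of a pair of `C^∞` maps.
[cite: WarnerGTM94, 2.17] -/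
theorem IsSmoothFormWedge_holds : IsSmoothFormWedge I M A := by
  intro k l α β hα hβ x
  rw [inChart_wedge]
  exact (hα x).wedge (hβ x)

end Smooth

end Literature.NumberTheory.Transcendental

namespace Literature.NumberTheory.Transcendental

/-! ### Reindexing alternating sums over permutations -/

section Reindex

variable {V : Type*} {β : Type*} [AddCommGroup β]

/-- Precomposing the tuple with a fixed permutation `ρ` multiplies an alternating sum over all
permutations by `sign ρ`. [folklore] -/
theorem sum_perm_sign_smul_comp_perm {n : ℕ} (f : (Fin n → V) → β) (w : Fin n → V)
    (ρ : Equiv.Perm (Fin n)) :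
    ∑ τ : Equiv.Perm (Fin n), (Equiv.Perm.sign τ : ℤ) • f (w ∘ τ ∘ ρ) =
      (Equiv.Perm.sign ρ : ℤ) • ∑ τ : Equiv.Perm (Fin n), (Equiv.Perm.sign τ : ℤ) • f (w ∘ τ) := by
  rw [Finset.smul_sum]
  refine Fintype.sum_equiv (Equiv.mulRight ρ) _ _ fun τ ↦ ?_
  simp only [Equiv.coe_mulRight, Equiv.Perm.coe_mul, smul_smul, Equiv.Perm.sign_mul,
    Units.val_mul]
  congr 1
  rw [mul_comm, mul_assoc, ← Units.val_mul, Int.units_mul_self, Units.val_one, mul_one]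

/-- Transport of an alternating sum over permutations along an equivalence of index types. [folklore] -/
theorem sum_perm_sign_smul_comp_equiv {m n : ℕ} (e : Fin m ≃ Fin n) (g : (Fin m → V) → β)
    (w : Fin n → V) :
    ∑ τ' : Equiv.Perm (Fin m), (Equiv.Perm.sign τ' : ℤ) • g (w ∘ e ∘ τ') =
      ∑ τ : Equiv.Perm (Fin n), (Equiv.Perm.sign τ : ℤ) • g (w ∘ τ ∘ e) := by
  refine Fintype.sum_equiv e.permCongr _ _ fun τ' ↦ ?_
  rw [Equiv.Perm.sign_permCongr]
  congr 2
  funext x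
  simp

end Reindex

/-! ### `alternatizeUncurryFin` of a wedge: the two halves of the Leibniz rule -/

section UncurryWedge

variable {𝕜 : Type*} [RCLike 𝕜] {V : Type*} [NormedAddCommGroup V] [NormedSpace 𝕜 V]
  {A : Type*} [NormedCommRing A] [NormedAlgebra 𝕜 A] {k l : ℕ}

/-- The shuffle formula for the wedge with integer-scalar signs. [folklore] -/
theorem wedge_apply_zsmul (α : V [⋀^Fin k]→L[𝕜] A) (β : V [⋀^Fin l]→L[𝕜] A) (v : Fin (k + l) → V) :
    α.wedge β v = ((k.factorial * l.factorial : ℕ) : 𝕜)⁻¹ • ∑ σ : Equiv.Perm (Fin (k + l)),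
      (Equiv.Perm.sign σ : ℤ) •
        (α (fun i ↦ v (σ (Fin.castAdd l i))) * β (fun j ↦ v (σ (Fin.natAdd k j)))) := by
  rw [ContinuousAlternatingMap.wedge_apply]
  simp only [Units.smul_def]

/-- **Left half of the Leibniz rule, pointwise.** For a linear family `φ` of `k`-forms and a fixed
`l`-form `ψ`, `alternatizeUncurryFin (v ↦ φ(v) ∧ ψ) = (alternatizeUncurryFin φ) ∧ ψ` (up to the
reindexing `(k+1)+l = (k+l)+1`). Both sides equal `(k! l!)⁻¹ ∑_τ sign τ · F(v ∘ τ)` with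
`F(z) = φ(z₀)(z₁,…,z_k) ψ(z_{k+1},…)`: the left by the first-slot expansion
(`sum_perm_sign_smul_comp_eq_sum_cons`), the right by moving the distinguished slot of
`alternatizeUncurryFin φ` to the front with a cycle of sign `(-1)^j`. [folklore] -/
theorem alternatizeUncurryFin_wedge_left (Φ : V →L[𝕜] V [⋀^Fin (k + l)]→L[𝕜] A)
    (φ : V →L[𝕜] V [⋀^Fin k]→L[𝕜] A) (ψ : V [⋀^Fin l]→L[𝕜] A) (hΦ : ∀ v, Φ v = (φ v).wedge ψ) :
    ContinuousAlternatingMap.alternatizeUncurryFin Φ =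
      ((ContinuousAlternatingMap.alternatizeUncurryFin φ).wedge ψ).domDomCongr
        (finCongr (Nat.add_right_comm k 1 l)) := by
  -- the common value
  set F : (Fin (k + l + 1) → V) → A := fun z ↦
    φ (z 0) (fun i ↦ z (Fin.succ (Fin.castAdd l i))) * ψ (fun j ↦ z (Fin.succ (Fin.natAdd k j)))
    with hF
  have hkl : ((k.factorial * l.factorial : ℕ) : 𝕜) ≠ 0 :=
    Nat.cast_ne_zero.2 (Nat.mul_ne_zero (Nat.factorial_ne_zero k) (Nat.factorial_ne_zero l))
  ext v
  -- left-hand side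
  have hL : ContinuousAlternatingMap.alternatizeUncurryFin Φ v =
      ((k.factorial * l.factorial : ℕ) : 𝕜)⁻¹ •
        ∑ τ : Equiv.Perm (Fin (k + l + 1)), (Equiv.Perm.sign τ : ℤ) • F (v ∘ τ) := by
    rw [ContinuousAlternatingMap.alternatizeUncurryFin_apply, sum_perm_sign_smul_comp_eq_sum_cons,
      Finset.smul_sum]
    refine Finset.sum_congr rfl fun i _ ↦ ?_
    rw [hΦ, wedge_apply_zsmul, smul_comm]
    congr 2
  -- right-hand side
  have hR : ((ContinuousAlternatingMap.alternatizeUncurryFin φ).wedge ψ)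
      (v ∘ finCongr (Nat.add_right_comm k 1 l)) =
      ((k.factorial * l.factorial : ℕ) : 𝕜)⁻¹ •
        ∑ τ : Equiv.Perm (Fin (k + l + 1)), (Equiv.Perm.sign τ : ℤ) • F (v ∘ τ) := by
    set e : Fin (k + 1 + l) ≃ Fin (k + l + 1) := finCongr (Nat.add_right_comm k 1 l) with he
    -- the summand for the `j`-th term of `alternatizeUncurryFin φ`
    set g : Fin (k + 1) → (Fin (k + 1 + l) → V) → A := fun j z ↦
      φ (z (Fin.castAdd l j)) (fun i ↦ z (Fin.castAdd l (j.succAbove i))) *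
        ψ (fun j' ↦ z (Fin.natAdd (k + 1) j')) with hg
    have h1 : ((ContinuousAlternatingMap.alternatizeUncurryFin φ).wedge ψ) (v ∘ e) =
        (((k + 1).factorial * l.factorial : ℕ) : 𝕜)⁻¹ •
          ∑ j : Fin (k + 1), (-1 : ℤ) ^ (j : ℕ) •
            ∑ τ' : Equiv.Perm (Fin (k + 1 + l)), (Equiv.Perm.sign τ' : ℤ) • g j (v ∘ e ∘ τ') := by
      rw [wedge_apply_zsmul]
      congr 1
      simp only [ContinuousAlternatingMap.alternatizeUncurryFin_apply, Finset.sum_mul,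
        Finset.smul_sum, smul_mul_assoc]
      rw [Finset.sum_comm]
      refine Finset.sum_congr rfl fun τ' _ ↦ Finset.sum_congr rfl fun j _ ↦ ?_
      rw [smul_comm]
      rfl
    -- each `j`-th term is `(-1)^j` times the common sum
    have h2 : ∀ j : Fin (k + 1),
        ∑ τ' : Equiv.Perm (Fin (k + 1 + l)), (Equiv.Perm.sign τ' : ℤ) • g j (v ∘ e ∘ τ') =
          (-1 : ℤ) ^ (j : ℕ) • ∑ τ : Equiv.Perm (Fin (k + l + 1)),
            (Equiv.Perm.sign τ : ℤ) • F (v ∘ τ) := by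
      intro j
      set J : Fin (k + l + 1) := ⟨j, by omega⟩ with hJ
      have hρ : ∀ τ : Equiv.Perm (Fin (k + l + 1)),
          g j (v ∘ τ ∘ e) = F (v ∘ τ ∘ J.cycleRange.symm) := by
        intro τ
        simp only [hg, hF, Function.comp_apply, Fin.cycleRange_symm_zero, Fin.cycleRange_symm_succ]
        congr 2
        · funext i
          refine congrArg v (congrArg τ (Fin.ext ?_))
          simp only [he, finCongr_apply, Fin.val_cast, Fin.val_castAdd, Fin.succAbove, Fin.lt_def,
            Fin.val_castSucc, hJ]
          split_ifs <;> simp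
        · funext j'
          refine congrArg v (congrArg τ (Fin.ext ?_))
          simp only [he, finCongr_apply, Fin.val_cast, Fin.val_natAdd, Fin.succAbove, Fin.lt_def,
            Fin.val_castSucc, hJ]
          rw [if_neg (by omega)]
          simp only [Fin.val_succ, Fin.val_natAdd]
          omega
      rw [sum_perm_sign_smul_comp_equiv e (g j) v]
      simp only [hρ]
      rw [sum_perm_sign_smul_comp_perm F v, Equiv.Perm.sign_symm, Fin.sign_cycleRange]
      rfl
    rw [h1]
    simp only [h2, smul_smul, ← pow_add, ← two_mul, pow_mul, neg_one_sq, one_pow, one_smul,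
      Finset.sum_const, Finset.card_univ, Fintype.card_fin]
    rw [← Nat.cast_smul_eq_nsmul 𝕜, smul_smul]
    congr 1
    rw [Nat.factorial_succ]
    push_cast
    field_simp
  rw [ContinuousAlternatingMap.domDomCongr_apply, hL, hR]

/-- **Right half of the Leibniz rule, pointwise.** For a fixed `k`-form `ψ` and a linear family `φ`
of `l`-forms, `alternatizeUncurryFin (v ↦ ψ ∧ φ(v)) = (-1)^k ψ ∧ alternatizeUncurryFin φ`. Both
sides equal `(k! l!)⁻¹ ∑_τ sign τ · F(v ∘ τ)` with `F(z) = ψ(z₁,…,z_k) φ(z₀)(z_{k+1},…)`; on the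
right the distinguished slot `k + j` of `alternatizeUncurryFin φ` is moved to the front with a
cycle of sign `(-1)^{k+j}`. [folklore] -/
theorem alternatizeUncurryFin_wedge_right (Φ : V →L[𝕜] V [⋀^Fin (k + l)]→L[𝕜] A)
    (ψ : V [⋀^Fin k]→L[𝕜] A) (φ : V →L[𝕜] V [⋀^Fin l]→L[𝕜] A) (hΦ : ∀ v, Φ v = ψ.wedge (φ v)) :
    ContinuousAlternatingMap.alternatizeUncurryFin Φ =
      ((-1 : 𝕜) ^ k • ψ.wedge (ContinuousAlternatingMap.alternatizeUncurryFin φ) :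
        V [⋀^Fin (k + l + 1)]→L[𝕜] A) := by
  -- the common value
  set F : (Fin (k + l + 1) → V) → A := fun z ↦
    ψ (fun i ↦ z (Fin.succ (Fin.castAdd l i))) * φ (z 0) (fun j ↦ z (Fin.succ (Fin.natAdd k j)))
    with hF
  have hkl : ((k.factorial * l.factorial : ℕ) : 𝕜) ≠ 0 :=
    Nat.cast_ne_zero.2 (Nat.mul_ne_zero (Nat.factorial_ne_zero k) (Nat.factorial_ne_zero l))
  ext v
  -- left-hand side
  have hL : ContinuousAlternatingMap.alternatizeUncurryFin Φ v =
      ((k.factorial * l.factorial : ℕ) : 𝕜)⁻¹ •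
        ∑ τ : Equiv.Perm (Fin (k + l + 1)), (Equiv.Perm.sign τ : ℤ) • F (v ∘ τ) := by
    rw [ContinuousAlternatingMap.alternatizeUncurryFin_apply, sum_perm_sign_smul_comp_eq_sum_cons,
      Finset.smul_sum]
    refine Finset.sum_congr rfl fun i _ ↦ ?_
    rw [hΦ, wedge_apply_zsmul, smul_comm]
    congr 2
  -- right-hand side
  have hR : (ψ.wedge (ContinuousAlternatingMap.alternatizeUncurryFin φ) :
      V [⋀^Fin (k + l + 1)]→L[𝕜] A) v =
      ((-1 : 𝕜) ^ k * ((k.factorial * l.factorial : ℕ) : 𝕜)⁻¹) •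
        ∑ τ : Equiv.Perm (Fin (k + l + 1)), (Equiv.Perm.sign τ : ℤ) • F (v ∘ τ) := by
    -- the summand for the `j`-th term of `alternatizeUncurryFin φ`
    set g : Fin (l + 1) → (Fin (k + l + 1) → V) → A := fun j z ↦
      ψ (fun i ↦ z (Fin.castAdd (l + 1) i)) *
        φ (z (Fin.natAdd k j)) (fun j' ↦ z (Fin.natAdd k (j.succAbove j'))) with hg
    have h1 : (ψ.wedge (ContinuousAlternatingMap.alternatizeUncurryFin φ) :
        V [⋀^Fin (k + l + 1)]→L[𝕜] A) v =
        ((k.factorial * (l + 1).factorial : ℕ) : 𝕜)⁻¹ •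
          ∑ j : Fin (l + 1), (-1 : ℤ) ^ (j : ℕ) •
            ∑ τ' : Equiv.Perm (Fin (k + l + 1)), (Equiv.Perm.sign τ' : ℤ) • g j (v ∘ τ') := by
      rw [show (ψ.wedge (ContinuousAlternatingMap.alternatizeUncurryFin φ) :
          V [⋀^Fin (k + l + 1)]→L[𝕜] A) v =
          (ψ.wedge (ContinuousAlternatingMap.alternatizeUncurryFin φ)) v from rfl, wedge_apply_zsmul]
      congr 1
      simp only [ContinuousAlternatingMap.alternatizeUncurryFin_apply, Finset.mul_sum,
        Finset.smul_sum, mul_smul_comm]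
      rw [Finset.sum_comm]
      refine Finset.sum_congr rfl fun τ' _ ↦ Finset.sum_congr rfl fun j _ ↦ ?_
      rw [smul_comm]
      rfl
    -- each `j`-th term is `(-1)^(k+j)` times the common sum
    have h2 : ∀ j : Fin (l + 1),
        ∑ τ' : Equiv.Perm (Fin (k + l + 1)), (Equiv.Perm.sign τ' : ℤ) • g j (v ∘ τ') =
          (-1 : ℤ) ^ (k + j : ℕ) • ∑ τ : Equiv.Perm (Fin (k + l + 1)),
            (Equiv.Perm.sign τ : ℤ) • F (v ∘ τ) := by
      intro j
      set J : Fin (k + l + 1) := ⟨k + j, by omega⟩ with hJ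
      have hρ : ∀ τ : Equiv.Perm (Fin (k + l + 1)),
          g j (v ∘ τ) = F (v ∘ τ ∘ J.cycleRange.symm) := by
        intro τ
        simp only [hg, hF, Function.comp_apply, Fin.cycleRange_symm_zero, Fin.cycleRange_symm_succ]
        congr 2
        · funext i
          refine congrArg v (congrArg τ (Fin.ext ?_))
          simp only [Fin.val_castAdd, Fin.succAbove, Fin.lt_def, Fin.val_castSucc, hJ]
          rw [if_pos (by omega)]
          simp
        · funext j'
          refine congrArg v (congrArg τ (Fin.ext ?_))
          simp only [Fin.val_natAdd, Fin.succAbove, Fin.lt_def, Fin.val_castSucc, hJ]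
          split_ifs <;> simp <;> omega
      simp only [hρ]
      rw [sum_perm_sign_smul_comp_perm F v, Equiv.Perm.sign_symm, Fin.sign_cycleRange]
      rfl
    rw [h1]
    simp only [h2, smul_smul, ← pow_add]
    have h3 : ∀ j : Fin (l + 1), (-1 : ℤ) ^ ((j : ℕ) + (k + j)) = (-1) ^ k := fun j ↦ by
      rw [show (j : ℕ) + (k + j) = k + 2 * j by ring, pow_add, pow_mul, neg_one_sq, one_pow,
        mul_one]
    simp only [h3, Finset.sum_const, Finset.card_univ, Fintype.card_fin]
    rw [← Nat.cast_smul_eq_nsmul 𝕜, smul_smul, ← Int.cast_smul_eq_zsmul 𝕜, smul_smul]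
    congr 1
    rw [Nat.factorial_succ]
    push_cast
    field_simp
  rw [hL, ContinuousAlternatingMap.smul_apply, hR, smul_smul, ← mul_assoc, ← pow_add, ← two_mul,
    pow_mul, neg_one_sq, one_pow, one_mul]

/-- **Leibniz rule for `extDerivWithin` and the wedge product** (flat case): for families of
alternating maps `f`, `g` on a normed space, differentiable within `s` at a point `x` of unique
differentiability,
`d(f ∧ g) = (df ∧ g) + (-1)^k (f ∧ dg)` at `x` (the first summand reindexed along
`(k+1)+l = (k+l)+1`). The derivative of the bilinear `y ↦ f(y) ∧ g(y)` is
`v ↦ f(x) ∧ Dg(v) + Df(v) ∧ g(x)` (`ContinuousLinearMap.fderivWithin_of_bilinear` for `wedgeCLM`),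
and `alternatizeUncurryFin` of the two pieces is computed by
`alternatizeUncurryFin_wedge_right/left`. Warner (1983), Thm. 2.20 (`d` is an antiderivation,
2.11(b)) and property (d) in its proof (the local computation); Mathlib has no wedge, hence no such
lemma. [cite: WarnerGTM94, Thm. 2.20 (antiderivation, 2.11(b); property (d) of the proof)] -/
theorem extDerivWithin_wedge {f : V → V [⋀^Fin k]→L[𝕜] A} {g : V → V [⋀^Fin l]→L[𝕜] A}
    {s : Set V} {x : V} (hf : DifferentiableWithinAt 𝕜 f s x) (hg : DifferentiableWithinAt 𝕜 g s x)
    (hs : UniqueDiffWithinAt 𝕜 s x) :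
    extDerivWithin (fun y ↦ (f y).wedge (g y)) s x =
      ((extDerivWithin f s x).wedge (g x)).domDomCongr (finCongr (Nat.add_right_comm k 1 l)) +
        ((-1 : 𝕜) ^ k • (f x).wedge (extDerivWithin g s x) : V [⋀^Fin (k + l + 1)]→L[𝕜] A) := by
  simp only [extDerivWithin]
  rw [show (fun y ↦ (f y).wedge (g y)) = fun y ↦ wedgeCLM 𝕜 V A k l (f y) (g y) from rfl,
    (wedgeCLM 𝕜 V A k l).fderivWithin_of_bilinear hf hg hs,
    ContinuousAlternatingMap.alternatizeUncurryFin_add,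
    alternatizeUncurryFin_wedge_right _ (f x) (fderivWithin 𝕜 g s x) (fun v ↦ rfl),
    alternatizeUncurryFin_wedge_left _ (fderivWithin 𝕜 f s x) (g x) (fun v ↦ rfl)]
  exact add_comm _ _

end UncurryWedge

/-! ### The chart at a point, without smoothness of the atlas -/

section ChartSelf

variable {E : Type*} [NormedAddCommGroup E] [NormedSpace ℝ E]
  {H : Type*} [TopologicalSpace H] {I : ModelWithCorners ℝ E H}
  {M : Type*} [TopologicalSpace M] [ChartedSpace H M]
  {F : Type*} [NormedAddCommGroup F] [NormedSpace ℝ F] {k : ℕ}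

/-- The round trip `extChartAt I x ∘ (extChartAt I x).symm` is the identity near the chart point
within `range I`. [folklore] -/
theorem extChartAt_comp_symm_eventuallyEq_id (x : M) :
    ((extChartAt I x) ∘ (extChartAt I x).symm) =ᶠ[𝓝[range I] (extChartAt I x x)] id :=
  Filter.eventuallyEq_of_mem (extChartAt_target_mem_nhdsWithin x)
    fun _ h ↦ (extChartAt I x).right_inv h

/-- **The derivative of the extended chart at its own centre is the identity, on a bare charted
space** (Mathlib's `mfderiv_extChartAt_self` assumes a `C¹` atlas; none is needed at the centre:
read in the chart at `x`, `extChartAt I x` is `extChartAt I x ∘ (extChartAt I x).symm = id` near the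
chart point). [folklore] -/
theorem mfderiv_extChartAt_self_of_chartedSpace (x : M) :
    mfderiv I 𝓘(ℝ, E) (extChartAt I x) x = ContinuousLinearMap.id ℝ E := by
  have hw : writtenInExtChartAt I 𝓘(ℝ, E) x (extChartAt I x) =
      (extChartAt I x) ∘ (extChartAt I x).symm := by
    funext y
    simp only [writtenInExtChartAt, extChartAt_model_space_eq_id, PartialEquiv.refl_coe,
      Function.comp_apply, id_eq]
  have hd : DifferentiableWithinAt ℝ (writtenInExtChartAt I 𝓘(ℝ, E) x (extChartAt I x)) (range I)
      (extChartAt I x x) := by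
    rw [hw]
    exact differentiableWithinAt_id.congr_of_eventuallyEq (extChartAt_comp_symm_eventuallyEq_id x)
      ((extChartAt I x).right_inv (mem_extChartAt_target x))
  rw [((mdifferentiableAt_iff _ _).2 ⟨continuousAt_extChartAt x, hd⟩).mfderiv, hw]
  exact fderivWithin_extChartAt_comp_extChartAt_symm_range

/-- **The derivative within `range I` of the inverse extended chart at the chart point is the
identity, on a bare charted space** (cf. Mathlib's
`mfderiv_extChartAt_comp_mfderivWithin_extChartAt_symm`, which assumes a `C¹` atlas). [folklore] -/
theorem mfderivWithin_extChartAt_symm_self_of_chartedSpace (x : M) :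
    (mfderivWithin 𝓘(ℝ, E) I (extChartAt I x).symm (range I) (extChartAt I x x) :
      E →L[ℝ] E) = ContinuousLinearMap.id ℝ E := by
  set c := extChartAt I x x with hc
  have hx : (extChartAt I x).symm c = x := extChartAt_to_inv x
  have hw : writtenInExtChartAt 𝓘(ℝ, E) I c (extChartAt I x).symm =
      (extChartAt I x) ∘ (extChartAt I x).symm := by
    funext y
    simp only [writtenInExtChartAt, hx, extChartAt_model_space_eq_id, PartialEquiv.refl_symm,
      PartialEquiv.refl_coe, Function.comp_apply, id_eq]
  have hs : (extChartAt 𝓘(ℝ, E) c).symm ⁻¹' range I ∩ range 𝓘(ℝ, E) = range I := by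
    simp only [extChartAt_model_space_eq_id, PartialEquiv.refl_symm, PartialEquiv.refl_coe,
      Set.preimage_id, modelWithCornersSelf_coe, Set.range_id, Set.inter_univ]
  have hcc : extChartAt 𝓘(ℝ, E) c c = c := by simp
  have hd : DifferentiableWithinAt ℝ (writtenInExtChartAt 𝓘(ℝ, E) I c (extChartAt I x).symm)
      ((extChartAt 𝓘(ℝ, E) c).symm ⁻¹' range I ∩ range 𝓘(ℝ, E)) (extChartAt 𝓘(ℝ, E) c c) := by
    rw [hw, hs, hcc]
    exact differentiableWithinAt_id.congr_of_eventuallyEq (extChartAt_comp_symm_eventuallyEq_id x)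
      ((extChartAt I x).right_inv (mem_extChartAt_target x))
  have hmd : MDifferentiableWithinAt 𝓘(ℝ, E) I (extChartAt I x).symm (range I) c :=
    (mdifferentiableWithinAt_iff' _ _ _).2 ⟨(continuousAt_extChartAt_symm x).continuousWithinAt, hd⟩
  rw [hmd.mfderivWithin, hw, hs, hcc]
  exact fderivWithin_extChartAt_comp_extChartAt_symm_range

/-- The chart representative at the centre of the chart is the form itself, on a bare charted space
(the tree's `MForm.inChart_apply_self` assumes `IsManifold I ∞ M`). [folklore] -/
theorem inChart_apply_self_of_chartedSpace (α : Literature.Geometry.Kaehler.MForm I M F k) (x : M) :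
    α.inChart x (extChartAt I x x) = α x := by
  ext v
  rw [Literature.Geometry.Kaehler.MForm.inChart_apply]
  have h : ∀ w : E, mfderivWithin 𝓘(ℝ, E) I (extChartAt I x).symm (range I) (extChartAt I x x) w =
      w := fun w ↦ by
    rw [mfderivWithin_extChartAt_symm_self_of_chartedSpace x]
    rfl
  simp only [h]
  rw [extChartAt_to_inv (I := I) x]
  rfl

/-- **The exterior derivative in the chart at the point**, on a bare charted space:
`dα x = extDerivWithin (α.inChart x) (range I) (extChartAt I x x)` (the tree's
`mextDeriv_eq_extDerivWithin` assumes `IsManifold I ∞ M`; the pull-back factor in the definition of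
`mextDeriv` is the identity by `mfderiv_extChartAt_self_of_chartedSpace`). [folklore] -/
theorem mextDeriv_eq_extDerivWithin_of_chartedSpace (α : Literature.Geometry.Kaehler.MForm I M F k)
    (x : M) :
    Literature.Geometry.Kaehler.mextDeriv α x =
      extDerivWithin (α.inChart x) (range I) (extChartAt I x x) := by
  simp only [Literature.Geometry.Kaehler.mextDeriv, mfderiv_extChartAt_self_of_chartedSpace]
  ext v
  rfl

end ChartSelf

/-! ### The Leibniz rule on manifolds (`MextDerivWedge` discharged) -/

section Leibniz

variable {E : Type*} [NormedAddCommGroup E] [NormedSpace ℝ E]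
  {H : Type*} [TopologicalSpace H] {I : ModelWithCorners ℝ E H}
  {M : Type*} [TopologicalSpace M] [ChartedSpace H M]
  {A : Type*} [NormedCommRing A] [NormedAlgebra ℝ A]

variable (I M A) in
/-- Discharge of the named fact `Literature.NumberTheory.Transcendental.MextDerivWedge`: **the Leibniz
rule** `d(α ∧ β) = dα ∧ β + (-1)^k α ∧ dβ` for smooth forms on a manifold (with corners; no
compatibility of the atlas is needed, both sides being computed in the chart at the point), for
all degrees and every normed commutative coefficient algebra `A` (Warner (1983), Thm. 2.20: `d` is
an antiderivation of degree `+1` — 2.11(b) — which is property (d) in the proof of 2.20; Bott–Tu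
(1982), §I.1, (1.5)). In the chart at `x` the representative of `α ∧ β` is the wedge of the
representatives (`inChart_wedge`), and the flat Leibniz rule `extDerivWithin_wedge` applies (smooth
forms are differentiable within `range I` at the chart point, a point of unique differentiability).
[cite: WarnerGTM94, Thm. 2.20 (antiderivation, 2.11(b); property (d) of the proof)] -/
theorem MextDerivWedge_holds : MextDerivWedge I M A := by
  intro k l α β hα hβ
  funext x
  have hU : UniqueDiffWithinAt ℝ (range I) (extChartAt I x x) :=
    I.uniqueDiffOn _ (extChartAt_target_subset_range x (mem_extChartAt_target x))
  rw [mextDeriv_eq_extDerivWithin_of_chartedSpace, inChart_wedge,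
    extDerivWithin_wedge ((hα x).differentiableWithinAt (by simp))
      ((hβ x).differentiableWithinAt (by simp)) hU,
    inChart_apply_self_of_chartedSpace, inChart_apply_self_of_chartedSpace,
    ← mextDeriv_eq_extDerivWithin_of_chartedSpace, ← mextDeriv_eq_extDerivWithin_of_chartedSpace]
  rfl

/-- With `IsSmoothFormWedge_holds` and `MextDerivWedge_holds`, the hypothesis class
`WedgeFacts I M A` of `FormsAlgebra.lean` reduces to the two pointwise algebraic facts
(associativity and graded commutativity of `∧` on the model space). [folklore] -/
theorem wedgeFacts_of_assoc_comm (hassoc : ContinuousAlternatingMap.WedgeAssoc ℝ E A)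
    (hcomm : ContinuousAlternatingMap.WedgeComm ℝ E A) : WedgeFacts I M A :=
  ⟨IsSmoothFormWedge_holds I M A, MextDerivWedge_holds I M A, hassoc, hcomm⟩

end Leibniz

end Literature.NumberTheory.Transcendental
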